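import Literature.MathematicalPhysics.QuantumFieldTheory.Balaban1983to89.B9CoReadingCoordsInput
import Literature.MathematicalPhysics.QuantumFieldTheory.Balaban1983to89.B9CoReadingCoordsHolderS

/-!
# `Balaban1983to89.B9CoReadingCoordsInputS` — the INPUT NORMS of the κ-fold coordinate model, SITE SECTOR: the (3.44)∕(3.45) input co-readings
# `InputReadsFam` of def-Y's reading `kernelFamilyS` (G′(U)) HOLD AT THE COORDINATE PINS, for every site-sector letter and EVERY configuration `U`

T. Bałaban, *Propagators for lattice gauge theories in a background field*, Commun. Math. Phys. **99** (1985) 389–434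
[`Balaban1985BackgroundPropagators`, "B9"]; [4] = T. Bałaban, *Propagators and renormalization transformations for lattice gauge
theories. II*, Commun. Math. Phys. **96** (1984) 223–250 [`Balaban1984PropagatorsII`].

statement-level skeleton of published theorems with citation tags; proofs where landed; nothing here is a claim about the
Yang–Mills mass gap

THE PRINTED LOCI.  [B9] (3.44)–(3.45) p. 398 for G′(U): *"|(G′(U)∇\*_Uλ)(x)|, |(∇_UG′(U)∇\*_Uλ)(x)| ≦ B₀(ε)…(‖λ‖_ε + |λ|)"*, *"‖ζ∇_UG′(U)∇\*_Uλ‖_α ≦ B₀(ε,α)(Lʲη)^{−α}(‖ζ‖^ξ_α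
+ |ζ|)…(‖λ‖_{α+ε} + |λ|)"* for `supp λ ⊂ Δ(y′)`; (3.39)–(3.41) p. 397; [4] Prop. 2.2 (2.67) p. 234 (`‖ζ‖_α`, `|ζ|` on the torus), (2.51)–(2.52) p. 232.

WHY THIS FILE (seat n06-d g6; the site twin of `B9CoReadingCoordsInput` — the LAST displayed co-reading binder `hIR` of the N06 certificate, row 18).  n06-k's
`InputReadsFam` for def-Y's SITE reading `kernelFamilyS` (`e4 = sup_E sup_{μ,ν} sup_{z∈Δ(y)} ‖∇_μO∇\*_ν(f⊗E)(z)‖`, `h2 = sup_E sup_{μ,ν} hqS (U(Γ)) α (ζ·∇_μO∇\*_ν(f⊗E))`,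
site arguments `.inl f`, site cut-offs `.inl ζ`) with the input norm ON THE SITE COORDINATE CARRIER `XSK κ i`:
* §1 ★ `bHS i sI ε : BlockNorm (toB6 (geo9K i) R H) (XSK κ i → ℝ)` — classes through a site block map `sI` (at the record `sIK bI`), `loc y F := supS + holS ε` (the
  class-restricted sup and the torus Hölder part over ALL pairs `w ≠ w′` with base point in the class, weight `((|w′−w|_T·η)^ε)⁻¹` = the weight inside def-Y's `hqS`
  and [4]'s `hqTP`, RESTRICTED values), `IsLoc`, the class-averaged sharp cut-offs of the bond file (`clsCard`), `κ = 1`.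
* §2 ★★ `inputReadsFam_kernelFamilyS_coords` — `InputReadsFam (kernelFamilyS i B cfg O par) U₁ (ε ↦ bHS i (sIK bI) ε) r (blkSK (sIK bI) ∘ fst) (blkPK (sIK bI) ∘ fst)
  (β ↦ sliceProbe (Φ^X_β of holderProbesS)) evSK (familyOp (q ↦ Dd q.1 ∘ GcoS ∘ Dds q.2))` at the pinned η⁻¹-scaled single-direction letters (n06-k
  `B9CoReadingCoordsL2S.pairS3_eq`: the member is `cR39 • coordOpK (∇_μ ∘ O ∘ ∇\*_ν)`), every letter, every `U₁`, `r ≥ 1`: `loc_le` against `hqTP ∕ supF`, `obs4` by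
  `wnorm_le_of_coords`, `obs5` by the site product rule `hqS_le_of_probes` of `B9CoReadingCoordsHolderS` (applied to the η⁻¹-scaled family, `coordOpK_smul_family`).
* §3 ★ `site_inputReadsFam_of_pins` (the certificate's site pins, radius 2).
HONEST SCOPE.  Finite-dimensional bookkeeping; nothing of [B9] or [4] asserted; COUNT-NEUTRAL; N06 NOT discharged; one finite 𝕋^{d+1} programme at fixed ε —
nothing continuum, nothing about the mass gap.  Cell `pub-ymgap` (HUMAN RULING D-0062), Track A node N06 [B9], seat `pub-ymgap-dag-n06-d` (g6), 2026-08-27.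
-/

noncomputable section

namespace Literature.MathematicalPhysics.QuantumFieldTheory.Balaban1983to89.B9CoReadingCoordsInputS

open B4TorusKernel.MultiPeriod (torusSupNorm torusSupNorm_nonneg)
open B6GlobalChartV1 (PV domT blkV1)
open B6Geom246MultiLevelBox (bset blkOf)
open B6Geom246MultiLevelTorus (geomT triangle_refl_nonneg_T)
open B6Ineq2142KLevelV1 (β lvl)
open B6KLevelCensusIndexV1 (KIdx kGeo)
open B6MultiLevelTorusOperator (one_le_N0)
open B6Prop22KLevelTorusCensus (KTIdx)
open B6Prop22KLevelTorusCensusEta (nKT nKT_pos hqTP hqTP_nonneg pair_le_hqTP geoTP)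
open B9GeoNormsKLevelV1 (geo9K geo9K_supNorm_nonneg geo9K_cutH_nonneg geo9K_holder_nonneg)
open B9Thm34Ext (toB6)
open B11SectG (BlockNorm)
open B9CoRealizesRelAtLetters (RelB relB_refl)
open B9RWSums344InputFam (InputReadsFam sliceProbe)
open B9RWSums346SecondDiff (familyOp)
open B9Ineq349SiteComposite (cdSL cdsSL etaS_pos)
open B9Thm39ReadingCoords (cR39 cR39_nonneg)
open B9CoReadingCoords (assembleK assembleK_smul evDiagK assembleK_evDiagK coordOpK coordOpK_apply coordOpK_comp assembleK_coordOpK coordOpK_evDiagK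
  abs_evDiagK_le evDiagK_eq_zero_of)
open B9CoReadingCoordsS (XSK evSK blkSK sIK sIK_faithful blkV1_site GcoS off_bound_evSK)
open B9CoReadingCoordsL2S (sIK_dist_le_one pairS3_eq)
open B9CoReadingCoordsHolder (PK blkPK probeK wnorm_le_of_coords)
open B9CoReadingCoordsHolderS (wS holderProbesS hqS_le_of_probes)
open B9CoReadingCoordsInput (clsCard one_le_clsCard clsCard_eq_of_relB sum_ite_relB)
open Node00 (SiteY FBondY IBondY CfgY BallY liftY supBlkS' hqS etaS toKT kernelFamilyS SiteOpY SiteParY cdS cdsS iSup_ball_le)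

variable {d ℓ : ℕ} {hd : 1 ≤ d + 1} {hL : Odd (ℓ + 1) ∧ 1 < ℓ + 1} {b₀ b₁ : ℝ}
variable {κ : Type} [Fintype κ] [DecidableEq κ]

/-! ## §1 The site input block norm: class-restricted sup + torus Hölder part, class-averaged sharp cut-offs -/

section InputNorm

variable (i : KIdx d ℓ hd hL b₀ b₁) [Fintype (geo9K i).Site] [DecidableRel (RelB i)] (sI : SiteY i → IBondY i)

/-- restriction of a site coordinate vector to the class of `y`. [cite: Balaban1985BackgroundPropagators, (3.44) p.398 («supp λ ⊂ Δ(y′)»), dictionary] -/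
def restrS (y : IBondY i) (F : XSK κ i → ℝ) : XSK κ i → ℝ := fun p => if RelB i (sI p.1) y then F p else 0

/-- the class-restricted sup. [cite: Balaban1985BackgroundPropagators, (3.39) p.397; Balaban1984PropagatorsII, (2.67) p.234 («|λ|»)] -/
def supS (y : IBondY i) (F : XSK κ i → ℝ) : ℝ := ⨆ p : XSK κ i, |restrS i sI y F p|

/-- the class-restricted torus Hölder part at scale `ε`: all pairs `w ≠ w′` with base point `w` in the class of `y`, the weight `((|w′−w|_T·η)^ε)⁻¹` of def-Y's
`hqS` ∕ [4]'s `hqTP`, RESTRICTED values. [cite: Balaban1985BackgroundPropagators, (3.40)–(3.41) p.397 + (3.44) p.398; Balaban1984PropagatorsII, (2.67) p.234 («‖λ‖_ε»)] -/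
def holS (ε : ℝ) (y : IBondY i) (F : XSK κ i → ℝ) : ℝ :=
  ⨆ q : (SiteY i × SiteY i) × Fin (d + 1) × κ × κ,
    if q.1.1 ≠ q.1.2 ∧ RelB i (sI q.1.1) y then wS i ε q.1.1 q.1.2 * |restrS i sI y F (q.1.2, q.2) - restrS i sI y F (q.1.1, q.2)| else 0

omit [Fintype κ] [DecidableEq κ] [Fintype (geo9K i).Site] in
/-- `restrS` is additive. [cite: Balaban1985BackgroundPropagators, (3.39) p.397, bookkeeping] -/
theorem restrS_add (y : IBondY i) (F G : XSK κ i → ℝ) : restrS i sI y (F + G) = restrS i sI y F + restrS i sI y G := by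
  funext p; by_cases h : RelB i (sI p.1) y <;> simp [restrS, h]

omit [Fintype κ] [DecidableEq κ] [Fintype (geo9K i).Site] in
/-- `restrS` of `−F`. [cite: Balaban1985BackgroundPropagators, (3.39) p.397, bookkeeping] -/
theorem restrS_neg (y : IBondY i) (F : XSK κ i → ℝ) : restrS i sI y (-F) = -restrS i sI y F := by
  funext p; by_cases h : RelB i (sI p.1) y <;> simp [restrS, h]

omit [Fintype κ] [DecidableEq κ] [Fintype (geo9K i).Site] in
/-- `0 ≤ supS`. [cite: Balaban1985BackgroundPropagators, (3.39) p.397, bookkeeping] -/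
theorem supS_nonneg (y : IBondY i) (F : XSK κ i → ℝ) : 0 ≤ supS i sI y F := Real.iSup_nonneg fun _ => abs_nonneg _

omit [Fintype κ] [DecidableEq κ] [Fintype (geo9K i).Site] in
/-- each summand of `holS` is `≥ 0`. [cite: Balaban1985BackgroundPropagators, (3.40) p.397, bookkeeping] -/
theorem holS_term_nonneg (ε : ℝ) (y : IBondY i) (F : XSK κ i → ℝ) (q : (SiteY i × SiteY i) × Fin (d + 1) × κ × κ) :
    0 ≤ (if q.1.1 ≠ q.1.2 ∧ RelB i (sI q.1.1) y then wS i ε q.1.1 q.1.2 * |restrS i sI y F (q.1.2, q.2) - restrS i sI y F (q.1.1, q.2)| else 0) := by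
  split_ifs
  · exact mul_nonneg (B9CoReadingCoordsHolderS.wS_nonneg i ε _ _) (abs_nonneg _)
  · exact le_rfl

omit [Fintype κ] [DecidableEq κ] [Fintype (geo9K i).Site] in
/-- `0 ≤ holS`. [cite: Balaban1985BackgroundPropagators, (3.40) p.397, bookkeeping] -/
theorem holS_nonneg (ε : ℝ) (y : IBondY i) (F : XSK κ i → ℝ) : 0 ≤ holS i sI ε y F := Real.iSup_nonneg (holS_term_nonneg i sI ε y F)

omit [DecidableEq κ] [Fintype (geo9K i).Site] in
/-- `supS (F + G) ≤ supS F + supS G`. [cite: Balaban1985BackgroundPropagators, (3.39) p.397, bookkeeping] -/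
theorem supS_add_le (y : IBondY i) (F G : XSK κ i → ℝ) : supS i sI y (F + G) ≤ supS i sI y F + supS i sI y G := by
  refine Real.iSup_le (fun p => ?_) (add_nonneg (supS_nonneg i sI y F) (supS_nonneg i sI y G))
  rw [restrS_add, Pi.add_apply]
  exact (abs_add_le _ _).trans (add_le_add (le_ciSup (f := fun p => |restrS i sI y F p|) (Finite.bddAbove_range _) p)
    (le_ciSup (f := fun p => |restrS i sI y G p|) (Finite.bddAbove_range _) p))

omit [DecidableEq κ] [Fintype (geo9K i).Site] in
/-- `holS (F + G) ≤ holS F + holS G`. [cite: Balaban1985BackgroundPropagators, (3.40) p.397, bookkeeping] -/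
theorem holS_add_le (ε : ℝ) (y : IBondY i) (F G : XSK κ i → ℝ) : holS i sI ε y (F + G) ≤ holS i sI ε y F + holS i sI ε y G := by
  refine Real.iSup_le (fun q => ?_) (add_nonneg (holS_nonneg i sI ε y F) (holS_nonneg i sI ε y G))
  have hF := le_ciSup (f := fun q : (SiteY i × SiteY i) × Fin (d + 1) × κ × κ => (if q.1.1 ≠ q.1.2 ∧ RelB i (sI q.1.1) y then
      wS i ε q.1.1 q.1.2 * |restrS i sI y F (q.1.2, q.2) - restrS i sI y F (q.1.1, q.2)| else 0)) (Finite.bddAbove_range _) q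
  have hG := le_ciSup (f := fun q : (SiteY i × SiteY i) × Fin (d + 1) × κ × κ => (if q.1.1 ≠ q.1.2 ∧ RelB i (sI q.1.1) y then
      wS i ε q.1.1 q.1.2 * |restrS i sI y G (q.1.2, q.2) - restrS i sI y G (q.1.1, q.2)| else 0)) (Finite.bddAbove_range _) q
  split_ifs with h
  · rw [if_pos h] at hF hG
    rw [restrS_add, Pi.add_apply, Pi.add_apply]
    have hw : 0 ≤ wS i ε q.1.1 q.1.2 := B9CoReadingCoordsHolderS.wS_nonneg i ε _ _
    calc wS i ε q.1.1 q.1.2 * |restrS i sI y F (q.1.2, q.2) + restrS i sI y G (q.1.2, q.2) -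
          (restrS i sI y F (q.1.1, q.2) + restrS i sI y G (q.1.1, q.2))|
        ≤ wS i ε q.1.1 q.1.2 * (|restrS i sI y F (q.1.2, q.2) - restrS i sI y F (q.1.1, q.2)| +
            |restrS i sI y G (q.1.2, q.2) - restrS i sI y G (q.1.1, q.2)|) := by
          refine mul_le_mul_of_nonneg_left ?_ hw
          calc _ = |(restrS i sI y F (q.1.2, q.2) - restrS i sI y F (q.1.1, q.2)) +
                (restrS i sI y G (q.1.2, q.2) - restrS i sI y G (q.1.1, q.2))| := by ring_nf
            _ ≤ _ := abs_add_le _ _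
      _ ≤ holS i sI ε y F + holS i sI ε y G := by rw [mul_add]; exact add_le_add hF hG
  · exact add_nonneg (holS_nonneg i sI ε y F) (holS_nonneg i sI ε y G)

/-- ★ **THE SITE INPUT BLOCK NORM OF THE COORDINATE CARRIER AT SCALE ε**: `loc y F := supS + holS ε`, `IsLoc y F` := `F` vanishes off the class of `y` (through `sI`),
`cut y` := the class-averaged sharp restriction, `κ = 1`. [cite: Balaban1985BackgroundPropagators, (3.39)–(3.41) p.397 + (3.44) p.398; Balaban1984PropagatorsII, (2.67) p.234, (2.51)–(2.52) p.232] -/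
def bHS {R : ℝ} {H : Prop} (ε : ℝ) : BlockNorm (toB6 (geo9K i) R H) (XSK κ i → ℝ) where
  loc := fun y F => supS i sI y F + holS i sI ε y F
  cut := fun y =>
    { toFun := fun F p => if RelB i (sI p.1) y then ((clsCard i (sI p.1) : ℝ))⁻¹ * F p else 0
      map_add' := fun F G => by funext p; by_cases h : RelB i (sI p.1) y <;> simp [h, mul_add]
      map_smul' := fun r F => by funext p; by_cases h : RelB i (sI p.1) y <;> simp [h, mul_left_comm] }
  IsLoc := fun y F => ∀ p : XSK κ i, ¬ RelB i (sI p.1) y → F p = 0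
  κ := 1
  κ_nonneg := zero_le_one
  loc_nonneg := fun y F => add_nonneg (supS_nonneg i sI y F) (holS_nonneg i sI ε y F)
  loc_zero := fun y => by
    have h0 : restrS i sI y (0 : XSK κ i → ℝ) = 0 := by funext p; simp [restrS]
    simp only [supS, holS, h0, Pi.zero_apply, abs_zero, sub_zero, mul_zero, ite_self, Real.iSup_const_zero, add_zero]
  loc_add_le := fun y F G => by
    calc supS i sI y (F + G) + holS i sI ε y (F + G) ≤ (supS i sI y F + supS i sI y G) + (holS i sI ε y F + holS i sI ε y G) :=
          add_le_add (supS_add_le i sI y F G) (holS_add_le i sI ε y F G)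
      _ = _ := by ring
  loc_neg := fun y F => by
    simp only [supS, holS, restrS_neg, Pi.neg_apply, abs_neg, neg_sub_neg, abs_sub_comm]
  sum_cut := fun F => by
    funext p
    simp only [Finset.sum_apply, LinearMap.coe_mk, AddHom.coe_mk]
    exact (sum_ite_relB i (toB6 (geo9K i) R H).fin (sI p.1) (((clsCard i (sI p.1) : ℝ))⁻¹ * F p)).trans
      (by rw [← mul_assoc, mul_inv_cancel₀ (by exact_mod_cast (Nat.pos_of_ne_zero (by have := one_le_clsCard i (sI p.1); omega)).ne' : (clsCard i (sI p.1) : ℝ) ≠ 0), one_mul])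
  isLoc_cut := fun y F p hp => by simp [hp]
  loc_cut_le := fun y F => by
    rw [one_mul]
    set c : ℝ := ((clsCard i y : ℝ))⁻¹ with hc
    have hc0 : 0 ≤ c := inv_nonneg.2 (Nat.cast_nonneg _)
    have hc1 : c ≤ 1 := inv_le_one_of_one_le₀ (by exact_mod_cast one_le_clsCard i y)
    have hres : restrS i sI y (fun p => if RelB i (sI p.1) y then ((clsCard i (sI p.1) : ℝ))⁻¹ * F p else 0) = c • restrS i sI y F := by
      funext p
      by_cases h : RelB i (sI p.1) y
      · simp only [restrS, if_pos h, Pi.smul_apply, smul_eq_mul, clsCard_eq_of_relB i h, hc]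
      · simp only [restrS, if_neg h, Pi.smul_apply, smul_eq_mul, mul_zero]
    have hsup : supS i sI y (fun p => if RelB i (sI p.1) y then ((clsCard i (sI p.1) : ℝ))⁻¹ * F p else 0) = c * supS i sI y F := by
      simp only [supS, hres, Pi.smul_apply, smul_eq_mul, abs_mul, abs_of_nonneg hc0]
      exact (Real.mul_iSup_of_nonneg hc0 _).symm
    have hhol : holS i sI ε y (fun p => if RelB i (sI p.1) y then ((clsCard i (sI p.1) : ℝ))⁻¹ * F p else 0) = c * holS i sI ε y F := by
      simp only [holS, hres, Pi.smul_apply, smul_eq_mul, ← mul_sub, abs_mul, abs_of_nonneg hc0]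
      rw [Real.mul_iSup_of_nonneg hc0]
      congr 1; funext q
      split_ifs <;> ring
    show supS i sI y (fun p => if RelB i (sI p.1) y then ((clsCard i (sI p.1) : ℝ))⁻¹ * F p else 0) +
        holS i sI ε y (fun p => if RelB i (sI p.1) y then ((clsCard i (sI p.1) : ℝ))⁻¹ * F p else 0) ≤ supS i sI y F + holS i sI ε y F
    rw [hsup, hhol]
    nlinarith [supS_nonneg i sI y F, holS_nonneg i sI ε y F]

end InputNorm

/-! ## §2 ★★ The input co-readings `InputReadsFam` ((3.44)∕(3.45)) of `kernelFamilyS` on the site pair-family coordinate model, input norm `bHS` -/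

section Smul

variable {𝔸 : Type} [NormedRing 𝔸] [NormedAlgebra ℂ 𝔸] (b : Module.Basis κ ℝ 𝔸)

omit [DecidableEq κ] in
/-- the coordinate model is linear in the family: `coordOpK b (ν ↦ s • T ν) = s • coordOpK b T`. [cite: Balaban1985BackgroundPropagators, (3.42) p.397, dictionary] -/
theorem coordOpK_smul_family {S D : Type} (s : ℝ) (T : D → (S → 𝔸) →ₗ[ℝ] (S → 𝔸)) :
    coordOpK b (fun ν => s • T ν) = s • coordOpK b T := by
  apply LinearMap.ext; intro f; funext p
  simp only [coordOpK_apply, LinearMap.smul_apply, Pi.smul_apply, map_smul, Finsupp.smul_apply, smul_eq_mul]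

end Smul

section Input

variable {𝔸 : Type} [NormedRing 𝔸] [NormedAlgebra ℂ 𝔸] [CompleteSpace 𝔸] [FiniteDimensional ℝ 𝔸]
variable (i : KIdx d ℓ hd hL b₀ b₁) [Fintype (geo9K i).Site] [DecidableRel (RelB i)] (b : Module.Basis κ ℝ 𝔸)
variable (B : B9.Backgrounds) (cfg : B.Cfg → CfgY 𝔸 i) (O : SiteOpY 𝔸 i) (par : SiteParY 𝔸 i) (U₁ : B.Cfg)
variable {bI : FBondY i → IBondY i}

omit [CompleteSpace 𝔸] [FiniteDimensional ℝ 𝔸] [NormedAlgebra ℂ 𝔸] [NormedRing 𝔸] [Fintype κ] [Fintype (geo9K i).Site] in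
/-- the class-restricted sup of the diagonal evaluation of a site function `f` is `≤ |f|`. [cite: Balaban1984PropagatorsII, (2.67) p.234 («|λ|»), bookkeeping] -/
theorem supS_evDiagK_le {sI : SiteY i → IBondY i} (y : IBondY i) (f : SiteY i → ℝ) :
    supS i sI y (evDiagK (κ := κ) (D := Fin (d + 1)) f) ≤ (geo9K i).supNorm (Sum.inl f) := by
  refine Real.iSup_le (fun p => ?_) (geo9K_supNorm_nonneg i _)
  unfold restrS
  split_ifs
  · exact (abs_evDiagK_le f p).trans (le_ciSup (f := fun x => |f x|) (Set.finite_range _).bddAbove p.1)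
  · rw [abs_zero]; exact geo9K_supNorm_nonneg i _

omit [CompleteSpace 𝔸] [FiniteDimensional ℝ 𝔸] [NormedAlgebra ℂ 𝔸] [NormedRing 𝔸] [Fintype κ] [Fintype (geo9K i).Site] in
/-- the class-restricted torus Hölder part of the diagonal evaluation of a site function `f` supported in the class of `y′` is `≤ ‖f‖_ε` (`hqTP`): a partner outside the
class has `f = 0` there, so the restricted difference IS `|f w′ − f w|` (`pair_le_hqTP`). [cite: Balaban1984PropagatorsII, (2.67) p.234 («‖λ‖_ε»); Balaban1985BackgroundPropagators, (3.44) p.398] -/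
theorem holS_evDiagK_le {sI : SiteY i → IBondY i}
    (hσI : ∀ (z : SiteY i) (c : IBondY i), blkOf i.D.toDomains z = β i.hN i.D i.hk c → β i.hN i.D i.hk (sI z) = blkOf i.D.toDomains z)
    (ε : ℝ) (y' : IBondY i) (f : SiteY i → ℝ) (hs : (geo9K i).suppIn (Sum.inl f) y') :
    holS i sI ε y' (evDiagK (κ := κ) (D := Fin (d + 1)) f) ≤ (geo9K i).holder ε (Sum.inl f) := by
  have hf0 : ∀ w', ¬ RelB i (sI w') y' → f w' = 0 := by
    intro w' hw'
    by_contra hf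
    exact hw' ((hσI w' y' (hs w' hf)).trans (hs w' hf))
  refine Real.iSup_le (fun q => ?_) (geo9K_holder_nonneg i ε _)
  split_ifs with h
  · obtain ⟨hne, hrel⟩ := h
    have hterm : wS i ε q.1.1 q.1.2 * |f q.1.2 - f q.1.1| ≤ (geo9K i).holder ε (Sum.inl f) := by
      have hq : wS i ε q.1.1 q.1.2 * |f q.1.2 - f q.1.1| = |f q.1.2 - f q.1.1| / (torusSupNorm (toKT i).NB (q.1.2.1 - q.1.1.1) / (nKT (toKT i))) ^ ε := by
        simp only [wS, div_eq_mul_inv]; ring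
      rw [hq]
      exact pair_le_hqTP (toKT i) ε f q.1.1 q.1.2 hne
    refine le_trans (mul_le_mul_of_nonneg_left ?_ (B9CoReadingCoordsHolderS.wS_nonneg i ε _ _)) hterm
    simp only [restrS, if_pos hrel, evDiagK]
    by_cases hc : q.2.2.1 = q.2.2.2
    · simp only [hc, if_true]
      by_cases hr : RelB i (sI q.1.2) y'
      · rw [if_pos hr]
      · rw [if_neg hr, hf0 q.1.2 hr]
    · simp only [hc, if_false, ite_self, sub_zero, abs_zero]; exact abs_nonneg _
  · exact geo9K_holder_nonneg i ε _

/-- ★★ **THE INPUT CO-READINGS (3.44)∕(3.45) OF `kernelFamilyS` HOLD ON THE SITE PAIR-FAMILY COORDINATE MODEL WITH THE INPUT NORM `bHS`** — for EVERY site-sector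
letter `O`, EVERY `U₁`, every real basis `b`, every `r ≥ 1`, given `bI` carrier-faithful (`hβI`) and 1-faithful (`hβ1`): `bH := bHS i (sIK bI)`, the pair family over the
η²·cR39-scaled model `GcoS` and the pinned η⁻¹-scaled single-direction letters (`pairS3_eq`: the member IS `cR39 • coordOpK (∇_μ ∘ O ∘ ∇\*_ν)`), the sliced Hölder
probes `holderProbesS`; `obs5` through `hqS_le_of_probes` on the η⁻¹-scaled constant family (def-Y's `h2` carries no η, its `h1` does).
[cite: Balaban1985BackgroundPropagators, (3.44)–(3.45) p.398 + (3.39)–(3.42) p.397; Balaban1984PropagatorsII, (2.67) p.234, (2.51)–(2.52) p.232] -/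
theorem inputReadsFam_kernelFamilyS_coords
    (hβI : ∀ (x : FBondY i) (c : IBondY i), blkV1 i.hN i.D x = β i.hN i.D i.hk c → β i.hN i.D i.hk (bI x) = blkV1 i.hN i.D x)
    (hβ1 : ∀ x : FBondY i, (geomT i.D).dist (β i.hN i.D i.hk (bI x)) (blkV1 i.hN i.D x) ≤ 1) {r : ℝ} (hr : 1 ≤ r) {R : ℝ} {H : Prop}
    {Dd Dds : Fin (d + 1) → ((XSK κ i → ℝ) →ₗ[ℝ] (XSK κ i → ℝ))}
    (hDd : Dd = fun μ => (etaS i)⁻¹ • coordOpK b (fun _ : Fin (d + 1) => (cdSL i (cfg U₁) μ).restrictScalars ℝ))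
    (hDds : Dds = fun μ => (etaS i)⁻¹ • coordOpK b (fun _ : Fin (d + 1) => (cdsSL i (cfg U₁) μ).restrictScalars ℝ)) :
    InputReadsFam (R := R) (H := H) (kernelFamilyS i B cfg O par) U₁ (fun ε => bHS i (sIK i bI) ε) r (blkSK i (sIK i bI) ∘ Prod.fst)
      (blkPK (sIK i bI) ∘ Prod.fst) (fun β => sliceProbe ((holderProbesS i b B cfg par bI).ΦX U₁ β)) (evSK i)
      (familyOp fun q : Fin (d + 1) × Fin (d + 1) => Dd q.1 ∘ₗ (GcoS i b B cfg O U₁ ∘ₗ Dds q.2)) := by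
  subst hDd hDds
  set T : Fin (d + 1) → Fin (d + 1) → (SiteY i → 𝔸) →ₗ[ℝ] (SiteY i → 𝔸) :=
    fun μ ν => (cdSL i (cfg U₁) μ).restrictScalars ℝ ∘ₗ ((O (cfg U₁)).restrictScalars ℝ ∘ₗ (cdsSL i (cfg U₁) ν).restrictScalars ℝ) with hT
  have hmem : ∀ (μ ν : Fin (d + 1)) (F : XSK κ i → ℝ) (v : XSK κ i),
      (familyOp (fun q : Fin (d + 1) × Fin (d + 1) =>
        ((etaS i)⁻¹ • coordOpK b (fun _ : Fin (d + 1) => (cdSL i (cfg U₁) q.1).restrictScalars ℝ)) ∘ₗ (GcoS i b B cfg O U₁ ∘ₗ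
          ((etaS i)⁻¹ • coordOpK b (fun _ : Fin (d + 1) => (cdsSL i (cfg U₁) q.2).restrictScalars ℝ)))) F) (v, (μ, ν)) =
        (cR39 b • coordOpK b (fun _ : Fin (d + 1) => T μ ν)) F v := by
    intro μ ν F v
    show (((etaS i)⁻¹ • coordOpK b (fun _ : Fin (d + 1) => (cdSL i (cfg U₁) μ).restrictScalars ℝ)) ∘ₗ (GcoS i b B cfg O U₁ ∘ₗ
      ((etaS i)⁻¹ • coordOpK b (fun _ : Fin (d + 1) => (cdsSL i (cfg U₁) ν).restrictScalars ℝ)))) F v = _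
    rw [pairS3_eq]
  have hE' : ∀ E : BallY 𝔸, ‖(E : 𝔸)‖ ≤ 1 := fun E => mem_closedBall_zero_iff.1 E.2
  have hη : 0 < etaS i := etaS_pos i
  refine ⟨?_, ?_, ?_, ?_, ?_, ?_⟩
  · intro ε lam y' hs
    exact (off_bound_evSK (κ := κ) i (sIK_faithful i hβI)).1 lam y' hs
  · intro ε lam y' hs
    show supS i (sIK i bI) y' (evSK i lam) + holS i (sIK i bI) ε y' (evSK i lam) ≤ (geo9K i).holder ε lam + (geo9K i).supNorm lam
    cases lam with
    | inr J =>
        have h0 : evSK (κ := κ) i (Sum.inr J) = 0 := rfl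
        have hl : supS i (sIK i bI) y' (evSK (κ := κ) i (Sum.inr J)) + holS i (sIK i bI) ε y' (evSK (κ := κ) i (Sum.inr J)) = 0 := by
          rw [h0]; exact (bHS (R := R) (H := H) i (sIK i bI) ε).loc_zero y'
        rw [hl]; exact add_nonneg (geo9K_holder_nonneg i ε _) (geo9K_supNorm_nonneg i _)
    | inl f =>
        rw [add_comm]
        exact add_le_add (holS_evDiagK_le i (sIK_faithful i hβI) ε y' f hs) (supS_evDiagK_le i y' f)
  · intro ε lam
    exact add_nonneg (geo9K_holder_nonneg i ε lam) (geo9K_supNorm_nonneg i lam)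
  · intro β' ζ
    exact geo9K_cutH_nonneg i β' ζ
  · -- obs4
    intro lam y c hc hw
    cases lam with
    | inr J => exact hc
    | inl f =>
        show (⨆ E : BallY 𝔸, ⨆ μ : Fin (d + 1),
            supBlkS' i (β i.hN i.D i.hk y) (fun ν => cdS i (cfg U₁) μ (O (cfg U₁) (cdsS i (cfg U₁) ν (liftY f (E : 𝔸)))))) ≤ c
        refine iSup_ball_le (fun E => Real.iSup_le (fun μ => ?_) hc) hc
        unfold supBlkS'
        refine Real.iSup_le (fun p => ?_) hc
        split_ifs with hp
        · have hnear : (geomT i.D).dist (β i.hN i.D i.hk (sIK i bI p.1)) (β i.hN i.D i.hk y) ≤ r := by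
            have h1 := sIK_dist_le_one i hβ1 p.1
            rw [hp] at h1
            linarith
          have key := wnorm_le_of_coords b (T μ p.2) f p.1 zero_le_one hc (fun cc cc' => ?_) (hE' E)
          · rw [one_mul] at key
            exact key
          have h2 := hw ((p.1, μ, cc, cc'), (μ, p.2)) hnear
          have hev : evSK (κ := κ) i (Sum.inl f) = evDiagK f := rfl
          rw [hmem, hev] at h2
          simp only [LinearMap.smul_apply, Pi.smul_apply, coordOpK_evDiagK, smul_eq_mul] at h2
          rw [one_mul]; exact h2
        · exact hc
  · -- obs5
    intro lam β' ζ y c hc hcut hP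
    have h0 : 0 ≤ c * (geo9K i).cutH β' ζ := mul_nonneg hc (geo9K_cutH_nonneg i β' ζ)
    cases lam with
    | inr J => cases ζ with
      | inl zz => exact h0
      | inr zz => exact h0
    | inl f => cases ζ with
      | inr zz => exact h0
      | inl zz =>
          show (⨆ E : BallY 𝔸, ⨆ μ : Fin (d + 1), ⨆ ν : Fin (d + 1),
              hqS i (par (cfg U₁)) β' (fun w => ((zz w : ℝ) : ℂ) • cdS i (cfg U₁) μ (O (cfg U₁) (cdsS i (cfg U₁) ν (liftY f (E : 𝔸)))) w)) ≤
            c * (geoTP (toKT i)).cutH β' zz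
          refine iSup_ball_le (fun E => Real.iSup_le (fun μ => Real.iSup_le (fun ν => ?_) h0) h0) h0
          -- the η⁻¹-scaled constant family: `(ζ w · η) • (η⁻¹ T)(…) w = ζ w • T(…) w`
          have key := hqS_le_of_probes i b (sIK_dist_le_one i hβ1) hr (par (cfg U₁)) (fun _ : Fin (d + 1) => (etaS i)⁻¹ • T μ ν) f β' zz y hc hcut
            (fun p hp => by
              have h2 := hP (p, (μ, ν)) hp
              have hsl : (fun v => (familyOp (fun q : Fin (d + 1) × Fin (d + 1) =>
                  ((etaS i)⁻¹ • coordOpK b (fun _ : Fin (d + 1) => (cdSL i (cfg U₁) q.1).restrictScalars ℝ)) ∘ₗ (GcoS i b B cfg O U₁ ∘ₗ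
                    ((etaS i)⁻¹ • coordOpK b (fun _ : Fin (d + 1) => (cdsSL i (cfg U₁) q.2).restrictScalars ℝ)))) (evSK i (Sum.inl f))) (v, (μ, ν))) =
                  ((etaS i * cR39 b) • coordOpK b (fun _ : Fin (d + 1) => (etaS i)⁻¹ • T μ ν)) (evDiagK f) := by
                funext v
                have hev : evSK (κ := κ) i (Sum.inl f) = evDiagK f := rfl
                rw [hmem, hev, coordOpK_smul_family, smul_smul, mul_right_comm, mul_inv_cancel₀ hη.ne', one_mul]
              rw [← hsl]
              exact h2) E μ
          have hfun : (fun w => ((zz w * etaS i : ℝ) : ℂ) • ((etaS i)⁻¹ • T μ ν) (liftY f (E : 𝔸)) w) =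
              fun w => ((zz w : ℝ) : ℂ) • cdS i (cfg U₁) μ (O (cfg U₁) (cdsS i (cfg U₁) ν (liftY f (E : 𝔸)))) w := by
            funext w
            rw [LinearMap.smul_apply, Pi.smul_apply, ← Complex.coe_smul, smul_smul, Complex.ofReal_mul, mul_assoc, ← Complex.ofReal_mul,
              mul_inv_cancel₀ hη.ne', Complex.ofReal_one, mul_one]
            rfl
          rw [hfun] at key
          exact key

/-- ★ **THE SITE INPUT CO-READINGS UNDER THE CERTIFICATE'S PINS, RADIUS 2**: probes `𝔭 = holderProbesS …`, input norm `bH = bHS … (sIK bI)`, block map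
`blk = blkSK (sIK bI)`, `Gp = GcoS …`, the single-direction letters `Dd ∕ Dds` pinned to the η⁻¹-scaled coordinate letters ⇒ the shape of the certificate's binder `hIR` (row 18).
[cite: Balaban1985BackgroundPropagators, (3.44)–(3.45) p.398; Balaban1984PropagatorsII, (2.67) p.234] -/
theorem site_inputReadsFam_of_pins
    (hβI : ∀ (x : FBondY i) (c : IBondY i), blkV1 i.hN i.D x = β i.hN i.D i.hk c → β i.hN i.D i.hk (bI x) = blkV1 i.hN i.D x)
    (hβ1 : ∀ x : FBondY i, (geomT i.D).dist (β i.hN i.D i.hk (bI x)) (blkV1 i.hN i.D x) ≤ 1) {R : ℝ} {H : Prop}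
    {𝔭 : B9RWSums343Holder.HolderProbes (geo9K i) B (XSK κ i) (XSK κ i) (PK (SiteY i) (Fin (d + 1)) κ) (PK (SiteY i) (Fin (d + 1)) κ)}
    {bH : ℝ → BlockNorm (toB6 (geo9K i) R H) (XSK κ i → ℝ)} {blk : XSK κ i → IBondY i} {G : (XSK κ i → ℝ) →ₗ[ℝ] (XSK κ i → ℝ)}
    {Dd Dds : Fin (d + 1) → ((XSK κ i → ℝ) →ₗ[ℝ] (XSK κ i → ℝ))}
    (h𝔭 : 𝔭 = holderProbesS i b B cfg par bI) (hbH : bH = fun ε => bHS i (sIK i bI) ε) (hblk : blk = blkSK i (sIK i bI)) (hG : G = GcoS i b B cfg O U₁)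
    (hDd : Dd = fun μ => (etaS i)⁻¹ • coordOpK b (fun _ : Fin (d + 1) => (cdSL i (cfg U₁) μ).restrictScalars ℝ))
    (hDds : Dds = fun μ => (etaS i)⁻¹ • coordOpK b (fun _ : Fin (d + 1) => (cdsSL i (cfg U₁) μ).restrictScalars ℝ)) :
    InputReadsFam (R := R) (H := H) (kernelFamilyS i B cfg O par) U₁ bH 2 (blk ∘ Prod.fst) (𝔭.blkPX ∘ Prod.fst) (fun β => sliceProbe (𝔭.ΦX U₁ β)) (evSK i)
      (familyOp fun q : Fin (d + 1) × Fin (d + 1) => Dd q.1 ∘ₗ (G ∘ₗ Dds q.2)) := by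
  subst h𝔭 hbH hblk hG
  exact inputReadsFam_kernelFamilyS_coords i b B cfg O par U₁ hβI hβ1 (by norm_num) hDd hDds

end Input

end Literature.MathematicalPhysics.QuantumFieldTheory.Balaban1983to89.B9CoReadingCoordsInputS

end
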